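import Mathlib.Analysis.Complex.ExponentialBounds
import Mathlib.Algebra.Polynomial.Derivative
import Literature.NumberTheory.Sieve.MaynardTaoProofs
import Literature.NumberTheory.Sieve.MaynardSmallK
import Literature.NumberTheory.Sieve.MaynardK105
import Literature.NumberTheory.Sieve.PolymathBoundedGaps
import HarnessLib

/-!
# Barrier catalogue `Parity`: the ceiling `M_k ≤ (k/(k-1)) log k` of the multidimensional
# Selberg sieve functional (Polymath 8b, Corollary 6.4) and the GPY ceiling `4`

Catalogue entry (D-0021) for the summit `Parity`, sub-problem `GeneralizedHardyLittlewood`, in its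
existence weakening `DHL[k, j]` (tree `Literature.NumberTheory.Sieve.WeakDicksonHardyLittlewood`; `DHL[2, 2]` contains the
twin prime conjecture, `weakDHL_two_two_twinPrimes` below). The catalogued declaration is
`MaynardFunctionalCeiling` (docstring = BARRIER block). It is a THEOREM: the record is the tree's
named fact `Literature.NumberTheory.Sieve.maynardFunctional_le` (restated verbatim up to binders, `maynardFunctionalCeiling_iff`),
which is PROVED in `Literature/NumberTheory/Sieve/MaynardTaoProofs.lean`
(`Literature.NumberTheory.Sieve.maynardFunctional_le_holds`); this file adds the technique class it constrains — the
variational hypothesis of Polymath 8b Theorem 3.8 = Maynard 2015 Prop. 4.2, `MaynardCriterion θ k m`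
— and proves the no-go consequences: no admissible `F` meets the criterion for prime PAIRS
(`m = 1`) when `k ≤ 4` at any level `θ ≤ 1` (the source's remark after Corollary 6.4), nor when
`k ≤ 50` at any level `θ ≤ 1/2` (arithmetic instance of Corollary 6.4), and in general the
criterion forces `k > exp(2m/θ - 1)`. The earlier ceiling `4` for the one-dimensional
Goldston–Pintz–Yıldırım weights (Soundararajan's inequality) is vendored as a named fact; the printed
ceiling `M_{k,ε} ≤ (k/(k-1)) log(2k-1)` for the ε-enlarged functional of Theorem 3.12 (Proposition 6.5) is
stated here as the named fact `Polymath2014_epsFunctional_le` and PROVED in the tree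
(`Literature.NumberTheory.Sieve.polymathFunctional_le_log`, `Literature/NumberTheory/Sieve/PolymathMkEpsUpperBound.lean`;
discharge `Polymath2014_epsFunctional_le_holds` in the sibling `MaynardFunctionalCeilingProofs.lean`); its
arithmetic consequence at the Bombieri–Vinogradov threshold (`k ≤ 23` excluded for Theorem 3.12) is
proved below modulo the fact and unconditionally in the sibling file.

## What the sources print (verified on the page; arXiv page numbers)

* D. H. J. Polymath, *Variants of the Selberg sieve, and bounded intervals containing many primes*,
  Res. Math. Sci. 1:12 (2014) = arXiv:1407.4897 [cite: Polymath8b2014, Claim 3.1, Theorems 3.2, 3.8, 3.9, 3.12–3.15, Lemma 6.1, Corollaries 6.3, 6.4].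
  p. 8, Claim 3.1 (`DHL[k, j]`): "For any admissible `k`-tuple `ℋ = (h₁, …, h_k)` there exist
  infinitely many translates `n + ℋ` of `ℋ` which contain at least `j` primes."  Theorem 3.2:
  unconditionally (i) `DHL[50, 2]`, …, (vi) `DHL[k, m+1]` whenever `k ≥ C exp((4 - 28/157) m)`;
  under `EH[θ]` for all `θ < 1`: (vii) `DHL[54, 3]`, …, (xi) `DHL[k, m+1]` whenever
  `k ≥ C exp(2m)`; under `GEH[θ]` for all `θ < 1`: (xii) `DHL[3, 2]`, (xiii) `DHL[51, 3]`.
  p. 10, Theorem 3.8 (Sieving on the standard simplex): with `I(F) = ∫ F²`,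
  `J_i(F) = ∫ (∫ F dt_i)²`, `M_k = sup (∑ᵢ J_i(F))/I(F)` over square-integrable `F` supported on
  `R_k = {t ∈ [0,∞)^k : t₁ + ⋯ + t_k ≤ 1}` not a.e. zero: "Suppose that there is a fixed
  `0 < θ < 1` such that `EH[θ]` holds, and such that `M_k > 2m/θ`. Then `DHL[k, m+1]` holds."
  Theorem 3.9: (vii) `M_54 > 4.00238`, …, (xi) `M_k ≥ log k - C`.  Then: "in [maynard-new] it was
  shown that `M_5 > 2`, `M_105 > 4` … the sieves used on the bounded gap problem prior to the work in
  [maynard-new] would essentially correspond, in this notation, to the choice of functions `F` of the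
  special form `F(t₁,…,t_k) := f(t₁+⋯+t_k)`, which severely limits the size of the ratio in [the definition of `M_k`] (in
  particular, the analogue of `M_k` in this special case cannot exceed `4`, as shown in [sound]). In the
  converse direction, in Corollary 6.4 we will also show the upper bound `M_k ≤ (k/(k-1)) log k` for
  all `k ≥ 2`, which shows in particular that the bounds in (vii) and (xi) of the above theorem cannot
  be significantly improved. We remark that Theorem 3.9(vii) and the Bombieri-Vinogradov theorem also
  gives a weaker version `DHL[54, 2]` of Theorem 3.2(i)."
  p. 11, Theorem 3.12 (ε-enlarged simplex `(1+ε)·R_k`, truncated `J_{i,1-ε}`, `M_{k,ε}`; (i) `EH[θ]`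
  and `1 + ε < 1/θ`, or (ii) `GEH[θ]` and `ε < 1/(k-1)`; `M_{k,ε} > 2m/θ` gives `DHL[k, m+1]`);
  Theorem 3.13: (i) `M_{50,1/25} > 4.0043`, (xii′) `M_{4,0.168} > 2.00558`, (xiii)
  `M_{51,1/50} > 4.00156`; Theorem 3.14 (beyond the ε enlargement, `GEH`, `F` on `(k/(k-1))·R_k`
  with vanishing marginals); Theorem 3.15 (`k = 3`, `ε = 1/4`, ratio `> 2`), giving 3.2(xii).
  p. 24, Lemma 6.1 (Cauchy–Schwarz): positive measurable `G_i` on `R_k` with `∫₀^∞ G_i dt_i ≤ 1`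
  give `M_k ≤ ess sup_{R_k} ∑ᵢ 1/G_i`.  Corollary 6.3: `M_2 = 1/(1 - W(1/e)) = 1.38593…`.
  Corollary 6.4: "We have `M_k ≤ (k/(k-1)) log k` for any `k ≥ 2`."  Then: "Thus for instance one
  has `M_2 ≤ 2 log 2 = 1.38629…` … `M_4 ≤ (4/3) log 4 = 1.8454…` [sic; `= 1.8484…`], so that one cannot hope to
  establish `DHL[4,2]` (or `DHL[3,2]`) solely through Theorem 3.8 even when assuming GEH, and must
  rely instead on more sophisticated criteria for `DHL[k,m]` such as Theorem 3.12 or Theorem 3.14."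
  Proof: `G_i(t) := ((k-1)/log k) · (1 - t₁ - ⋯ - t_k + k t_i)⁻¹`, `∑ᵢ 1/G_i = (k/(k-1)) log k` on
  `R_k`.  Proposition 6.5 (p. 24): "For any `k ≥ 2` and `0 ≤ ε < 1` we have
  `M_{k,ε} ≤ (k/(k-1)) log(2k-1)`" ("the improvement in constants when moving from `M_k` to
  `M_{k,ε}` is asymptotically modest"); Remark 6.6: the weight `1 + a(-t₁ - ⋯ - t_k + k t_i)` gives
  `M_{k,ε} ≤ (k/(a(k-1))) log(k + (a(1+ε)-1)(k-1)/(1-a(1-ε)))` for `1/(1+ε) < a < 1/(1-ε)`.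
  p. 37 (§11): "Extrapolation of existing numerics also raises the possibility that `M_53` exceeds
  `4`, in which case the bound of `270` in Theorem 1.4(vii) could be lowered to `264`."
  p. 3 and abstract: "the parity problem [selberg] prohibits one from achieving any better bound on
  `H₁` than `6` from purely sieve-theoretic methods" (§8; tree entries
  `Literature/Barriers/Parity/PrimePairParity.lean`, `SelbergParity.lean`).
* K. Soundararajan, *Small gaps between prime numbers: the work of Goldston–Pintz–Yıldırım*,
  Bull. Amer. Math. Soc. 44 (2007) 1–18 = arXiv:math/0605696 [cite: Soundararajan2007SmallGaps, pp. 7–8 and p. 10].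
  p. 7: the weights `a(n) = (∑_{d ∣ (n+h₁)⋯(n+h_k), d ≤ R} λ_d)²` with
  `λ_d = μ(d) P(log(R/d)/log R)`, "`P(y)` denotes a polynomial such that `P(1) = 1` and such that `P`
  vanishes to order at least `k` at `y = 0`"; "we can only take `R` around size `x^{1/4}`".
  p. 8: the ratio (12) equals `(log R/log x) · (∫₀¹ y^{k-2}/(k-2)! P^{(k-1)}(1-y)² dy)/(∫₀¹ y^{k-1}/(k-1)! P^{(k)}(1-y)² dy)`
  and must exceed `1/k`; "Unfortunately, the second fraction in (12) cannot be made larger than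
  `4/k`. If we set `Q(y) = P^{(k-1)}(y)` then `Q` is a polynomial, not identically zero, with
  `Q(0) = 0`; for such polynomials `Q` we claim that the unfortunate inequality
  `∫₀¹ (y^{k-2}/(k-2)!) Q(1-y)² dy < (4/k) ∫₀¹ (y^{k-1}/(k-1)!) Q′(1-y)² dy` holds."  "Since we can
  choose `R` a little below `x^{1/4}`, the first fraction is close to but less than `1/4`. Thus (12) is
  very close to, but less than, `1/k`. We therefore barely fail to prove bounded gaps between primes!"
  "If we allow `R = x^{1/2-ε}` as the Elliott-Halberstam conjecture predicts, then with `k = 7` and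
  `r = 1` we can make (12) nearly `1.05/k > 1/k`."  p. 10: "the method in its present form cannot be
  pushed to yield twin primes".
* J. Maynard, *Small gaps between primes*, Ann. of Math. 181 (2015), Propositions 4.2, 4.3 — used
  only through the tree (`Literature.NumberTheory.Sieve.frequently_card_primes_ge_of_maynardFunctional`, named fact;
  `Literature.NumberTheory.Sieve.exists_two_lt_maynardFunctional_five_holds`, proved: `M_5 > 2`).
  [cite: MaynardAnnals2015, Propositions 4.2 and 4.3]

## Conventions

`maynardFunctional k F = (∑ₘ J_k^{(m)}(F))/I_k(F)` and `IsMaynardAdmissible k F` (measurable,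
supported in `R_k`, square-integrable, `I_k(F) > 0`) are the tree's (`MaynardTao.lean`), so that
"`M_k > 2m/θ`" is rendered `sSup`-free, exactly as in the tree's Theorem 3.8
(`Literature.NumberTheory.Sieve.weakDHL_of_maynardFunctional_gt`), by `MaynardCriterion θ k m`. Levels: `θ ≤ 1` covers
`EH[θ]` for every `θ < 1` (tree `Literature.NumberTheory.Sieve.LevelOfDistribution.ElliottHalberstam`), `θ ≤ 1/2` covers Bombieri–Vinogradov
(tree `Literature.BombieriVinogradovStatement : ∀ θ < 1/2, PrimesHaveLevel θ`). The numerical constant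
`2.7182818283 < e` is Mathlib's `Real.exp_one_gt_d9`.
-/

noncomputable section

open Filter Finset MeasureTheory
open scoped BigOperators

namespace Literature.Barriers.Parity

/-! ### The technique class: the Maynard criterion of Polymath 8b Theorem 3.8 -/

/-- **The Maynard criterion at level `θ` for `m + 1` primes in `k`-tuples**: there is an admissible
test function `F` on the simplex `R_k` with `(∑ᵢ J_k^{(i)}(F))/I_k(F) > 2m/θ` — the variational
hypothesis "`M_k > 2m/θ`" of Polymath 8b Theorem 3.8 (= Maynard 2015 Prop. 4.2) — its only
variational hypothesis, the others being `k ≥ 2`, `m ≥ 1`, `0 < θ < 1` and `EH[θ]`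
(`Literature.PrimesHaveLevel θ`); rendered `sSup`-free with the tree's `Literature.NumberTheory.Sieve.IsMaynardAdmissible`,
`Literature.NumberTheory.Sieve.maynardFunctional`, exactly as in `Literature.NumberTheory.Sieve.frequently_card_primes_ge_of_maynardFunctional`. Intended
for `θ > 0` (for `θ ≤ 0` it is trivially inhabited, as `2m/θ ≤ 0`); every theorem below carries
`0 < θ`. [cite: Polymath8b2014, Theorem 3.8] -/
def MaynardCriterion (θ : ℝ) (k m : ℕ) : Prop :=
  ∃ F : (Fin k → ℝ) → ℝ, Literature.NumberTheory.Sieve.IsMaynardAdmissible k F ∧ 2 * (m : ℝ) / θ < Literature.NumberTheory.Sieve.maynardFunctional k F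

/-- What the technique delivers (Polymath 8b Theorem 3.8 in the tree's `DHL` rendering
`Literature.NumberTheory.Sieve.weakDHL_of_maynardFunctional_gt`, from the named fact
`Literature.NumberTheory.Sieve.frequently_card_primes_ge_of_maynardFunctional` = Maynard 2015 Prop. 4.2): level `θ` plus the
criterion give `DHL[k, m+1]`. [cite: Polymath8b2014, Theorem 3.8] -/
theorem MaynardCriterion.weakDHL {θ : ℝ} {k m : ℕ} (hc : MaynardCriterion θ k m)
    (h38 : Literature.NumberTheory.Sieve.frequently_card_primes_ge_of_maynardFunctional) (hθ : 0 < θ)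
    (hlev : Literature.NumberTheory.Sieve.PrimesHaveLevel θ) : Literature.NumberTheory.Sieve.WeakDicksonHardyLittlewood k (m + 1) := by
  obtain ⟨F, hF, hM⟩ := hc
  exact Literature.NumberTheory.Sieve.weakDHL_of_maynardFunctional_gt h38 hθ hlev hF hM

/-- `DHL[2, 2]` (every admissible pair is a prime pair infinitely often) contains the twin prime
conjecture (tree `Literature.NumberTheory.Sieve.TwinPrimeConjecture`), via the admissible pair `(0, 2)`
(`Literature.NumberTheory.Sieve.isAdmissibleTuple_pair`): the `k = 2`, `m = 1` output of Theorem 3.8 would be the existence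
form of the binary case of the prime-tuples conjecture ("The twin prime conjecture asserts that
`H₁ = 2`"). [cite: Polymath8b2014, Claim 3.1 and §1] -/
theorem weakDHL_two_two_twinPrimes (h : Literature.NumberTheory.Sieve.WeakDicksonHardyLittlewood 2 2) :
    Literature.NumberTheory.Sieve.TwinPrimeConjecture := by
  intro N
  have hfr := h ({0, 2} : Finset ℤ) Literature.NumberTheory.Sieve.isAdmissibleTuple_pair (by decide)
  obtain ⟨n, hn, hcard⟩ := Filter.frequently_atTop.1 hfr (N + 1)
  have hsub : ({0, 2} : Finset ℤ).filter
      (fun h ↦ 0 < (n : ℤ) + h ∧ ((n : ℤ) + h).toNat.Prime) = {0, 2} :=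
    Finset.eq_of_subset_of_card_le (Finset.filter_subset _ _) (by simpa using hcard)
  have h0 : (0 : ℤ) ∈ ({0, 2} : Finset ℤ).filter
      (fun h ↦ 0 < (n : ℤ) + h ∧ ((n : ℤ) + h).toNat.Prime) := by
    rw [hsub]; simp
  have h2 : (2 : ℤ) ∈ ({0, 2} : Finset ℤ).filter
      (fun h ↦ 0 < (n : ℤ) + h ∧ ((n : ℤ) + h).toNat.Prime) := by
    rw [hsub]; simp
  rw [Finset.mem_filter] at h0 h2
  have e0 : ((n : ℤ) + 0).toNat = n := by omega
  have e2 : ((n : ℤ) + 2).toNat = n + 2 := by omega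
  refine ⟨n, by omega, ?_, ?_⟩
  · simpa [e0] using h0.2.2
  · simpa [e2] using h2.2.2

/-! ### The record: Polymath 8b Corollary 6.4 (proved in the tree) -/

/-- **Polymath 8b, Corollary 6.4: `M_k ≤ (k/(k-1)) log k` for every `k ≥ 2`** — for every admissible
`F` on `R_k`, `(∑ᵢ J_k^{(i)}(F))/I_k(F) ≤ (k/(k-1)) log k`. This is the tree's named fact
`Literature.NumberTheory.Sieve.maynardFunctional_le` (`maynardFunctionalCeiling_iff`), PROVED there as
`Literature.NumberTheory.Sieve.maynardFunctional_le_holds`; consequences for the criterion of Theorem 3.8 are proved below.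

BARRIER (D-0021; one line per key):
technique_class: multidimensional-selberg-sieve maynard-tao-variational-criterion gpy-weights — deductions of `DHL[k, m+1]` (tree `Literature.WeakDicksonHardyLittlewood k (m+1)`: every admissible `k`-tuple has infinitely many translates containing `m + 1` primes) from a level of distribution `θ` of the primes (`Literature.PrimesHaveLevel θ`, i.e. `EH[θ]`; Bombieri–Vinogradov gives every `θ < 1/2`) through Polymath 8b Theorem 3.8 = Maynard 2015 Prop. 4.2, "Suppose that there is a fixed `0 < θ < 1` such that `EH[θ]` holds, and such that `M_k > 2m/θ`. Then `DHL[k, m+1]` holds", whose sieve weights are `ν(n) = (∑ⱼ cⱼ λ_{F_{j,1}}(n+h₁)⋯λ_{F_{j,k}}(n+h_k))²` with `F` supported on the simplex `R_k` and whose only variational input is, formally, `MaynardCriterion θ k m := ∃ F, IsMaynardAdmissible k F ∧ 2m/θ < maynardFunctional k F` (`MaynardCriterion.weakDHL`) [cite: Polymath8b2014, Theorem 3.8 and §3 (the weights ν, λ_F before Theorem 3.5)] [cite: MaynardAnnals2015, Proposition 4.2]; and the predecessor class of one-dimensional GPY weights `λ_d = μ(d) P(log(R/d)/log R)`, i.e.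 `F(t) = f(t₁ + ⋯ + t_k)` [cite: Soundararajan2007SmallGaps, p. 7] [cite: Polymath8b2014, §3 (remark after Theorem 3.9)].
blocks: (i) prime PAIRS in short admissible tuples by Theorem 3.8 at ANY level `θ ≤ 1`, hence even under the (generalized) Elliott–Halberstam conjecture: for `k ∈ {2, 3, 4}` no admissible `F` satisfies the criterion with `m = 1` (`not_maynardCriterion_pairs_of_le_one`, proved: `(k/(k-1)) log k < 2 ≤ 2/θ`), in particular not for `k = 2`, whose output `DHL[2, 2]` contains the twin prime conjecture = existence form of the binary case of `GeneralizedHardyLittlewood` (`weakDHL_two_two_twinPrimes`) — "`M_4 ≤ (4/3) log 4 = 1.8454…` [sic], so that one cannot hope to establish `DHL[4,2]` (or `DHL[3,2]`) solely through Theorem 3.8 even when assuming GEH" [cite: Polymath8b2014, §6 (remark after Corollary 6.4, p. 24)]; (ii) at Bombieri–Vinogradov level (`θ ≤ 1/2`, where the criterion needs a functional `> 4`): no admissible `F` for any `k ≤ 50` (`not_maynardCriterion_pairs_of_le_half`, proved; the arithmetic instance `(50/49) log 50 = 3.99… < 4` of Corollary 6.4, while `(51/50) log 51 = 4.01… > 4`,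 `four_lt_ceiling_fiftyOne`) — the printed unconditional use of Theorem 3.8 is `DHL[54, 2]` from `M_54 > 4.00238`, and Corollary 6.4 "shows in particular that the bounds in (vii) and (xi) of the above theorem cannot be significantly improved" [cite: Polymath8b2014, Theorem 3.9 and the remark following it (p. 10)]; (iii) in general the criterion forces `2m/θ < (k/(k-1)) log k ≤ log k + 1`, i.e. `k > exp(2m/θ - 1)` (`MaynardCriterion.lt_ceiling`, `MaynardCriterion.exp_lt`, proved): `m + 1` primes in a `k`-tuple by Theorem 3.8 need `k` exponentially large in `m/θ`, the shape `k ≥ C exp(2m)` of Theorem 3.2(xi) under EH [cite: Polymath8b2014, Theorem 3.2(xi) and Corollary 6.4]; (iv) for the one-dimensional GPY weights the second factor of the ratio (12) "cannot be made larger than `4/k`", so with `R` "a little below `x^{1/4}`" (Bombieri–Vinogradov) "(12) is very close to, but less than, `1/k`. We therefore barely fail to prove bounded gaps between primes!" (`Soundararajan2007_gpyCeiling`, named fact) [cite: Soundararajan2007SmallGaps, p. 8].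
because: Cauchy–Schwarz on each fibre (Lemma 6.1): positive `G_i` on `R_k` with `∫₀^∞ G_i dt_i ≤ 1` give `J_i(F) ≤ ∫_{R_k} F²/G_i`, hence `M_k ≤ ess sup ∑ᵢ 1/G_i`; the weights `G_i(t) = ((k-1)/log k)(1 - t₁ - ⋯ - t_k + k t_i)⁻¹` satisfy `∫ G_i dt_i ≤ 1` and `∑ᵢ 1/G_i = (k/(k-1)) log k` identically on `R_k` (proof of Corollary 6.4) [cite: Polymath8b2014, Lemma 6.1 and Corollary 6.4 (proof, p. 24)]; formal proof in the tree, `Literature.NumberTheory.Sieve.maynardFunctional_le_holds` (`Literature/NumberTheory/Sieve/MaynardTaoProofs.lean`).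
evasions_known: (a) enlarge the support of `F` beyond `R_k`: the ε-enlarged simplex with truncated `J_{i,1-ε}` (Theorem 3.12: `M_{50,1/25} > 4.0043` gives `DHL[50, 2]` and `H₁ ≤ 246` from Bombieri–Vinogradov — tree `Literature.NumberTheory.Sieve.weakDHL_fifty_two`; `M_{4,0.168} > 2.00558`) and, under `GEH`, functions on `(k/(k-1))·R_k` with vanishing marginals (Theorems 3.14, 3.15: `DHL[3, 2]`, `H₁ ≤ 6`) [cite: Polymath8b2014, Theorems 3.12–3.15 and Theorem 3.2(i), (xii)]; for `M_{k,ε}` only the weaker ceiling `M_{k,ε} ≤ (k/(k-1)) log(2k-1)` is printed (`Polymath2014_epsFunctional_le`, named fact PROVED in the tree as `Literature.NumberTheory.Sieve.polymathFunctional_le_log` — the printed proof sums the fibrewise Cauchy–Schwarz bounds with Corollary 6.4's weight `1 - σ + k tᵢ` as if `∑ᵢ 1_{Eᵢ}(1 - σ + k tᵢ) ≤ k` pointwise, which fails on `1 < σ ≤ 1+ε` and yields only `((k + (k-1)ε)/(k-1)) log(2k-1)`; the tree completes it with a two-zone weight, `PolymathMkEpsWeights.lean`; at the Bombieri–Vinogradov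 threshold `4` the ceiling excludes exactly `k ≤ 23` for the criterion of Theorem 3.12, `not_polymathCriterion_pairs_of_le_half`, unconditional as `not_polymathCriterion_pairs_of_le_half_holds` in `MaynardFunctionalCeilingProofs.lean`, and nothing at threshold `2` since `2 log 3 > 2`; the tree also proves `M_{k,ε} ≤ 2ε + (1-ε)((k/(k-1)) log k + H_{k-1})`, `Literature.NumberTheory.Sieve.polymathFunctional_le_regimeB`, which tends to the limit `2` of Remark after Prop. 6.5 as `ε → 1`) [cite: Polymath8b2014, Proposition 6.5 and §6 (M_{2,ε})]; (b) increase `k`: `M_5 > 2` (`maynardCriterion_five`, from the tree's proved `Literature.NumberTheory.Sieve.exists_two_lt_maynardFunctional_five_holds`; `H₁ ≤ 12` under EH) and `M_105 > 4` (`maynardCriterion_oneOhFive`, from the tree's proved `Literature.NumberTheory.Sieve.exists_four_lt_maynardFunctional_holds`; `H₁ ≤ 600`), `M_54 > 4.00238` (`DHL[54, 2]`, `H₁ ≤ 270`, from Bombieri–Vinogradov through Theorem 3.8 itself) [cite: MaynardAnnals2015, Proposition 4.3] [cite: Polymath8b2014, Theorem 3.9(vii)]; (c) distribution beyond `1/2`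 for smooth moduli (`MPZ[ϖ, δ]`) with the truncated simplex, Theorems 3.10–3.11 [cite: Polymath8b2014, Theorems 3.10 and 3.11]; (d) the passage from the one-dimensional GPY weights to general `F` on `R_k` is itself the evasion of (iv): by (iv) the GPY ratio (12) is `< (log R/log x)(4/k)`, so GPY needs `R` "a little larger than `x^{1/4}`" (moduli `[d₁, d₂] ≤ R²` beyond `x^{1/2}`, i.e. level of distribution beyond Bombieri–Vinogradov) and then succeeds "for suitably large `k`" (under Elliott–Halberstam: `k = 6`, gaps `≤ 16`), while Maynard's `M_105 > 4` needs only Bombieri–Vinogradov [cite: Soundararajan2007SmallGaps, p. 8] [cite: Polymath8b2014, §3 (remark after Theorem 3.9)].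
scope_caveats: (a) Corollary 6.4 bounds the functional of Theorem 3.8 only (`F` supported on `R_k`; a fortiori the truncated `M_k^{[α]} ≤ M_k` of Theorem 3.10); it does not bound `M_{k,ε}` beyond Proposition 6.5 (evasion (a)), says nothing about the class of Theorem 3.14, and nothing about sieve weights outside the Selberg-square family `ν = (∑ⱼ cⱼ ∏ᵢ λ_{F_{j,i}}(n+hᵢ))²` of §3 — the only printed limitation for "purely sieve-theoretic" arguments in general is the parity bound `H₁ ≥ 6` of §8 (tree entries `PrimePairParity`, `SelbergParity`) [cite: Polymath8b2014, §8 and p. 3]; (b) the ceiling is not sharp (`M_2 = 1/(1 - W(1/e)) = 1.38593… < 2 log 2 = 1.38629…`, Corollary 6.3) and for `k ≥ 3` its distance to `M_k` is controlled only by `M_k ≥ log k - C` (Theorem 3.9(xi); Theorem 6.7 for `M_k^{[T]}`); "the possibility that `M_53` exceeds `4`" is left open — so (ii) does NOT say that `k = 51, 52, 53` are reachable by Theorem 3.8 from Bombieri–Vinogradov, only that `k ≤ 50` is not [cite: Polymath8b2014, Corollary 6.3, Theorem 3.9(xi) and §11 (p. 37)]; (c) the no-go theorems below quantify over all `0 <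 θ ≤ 1` (resp. `θ ≤ 1/2`) and assert the emptiness of the criterion; they do not depend on, or speak to, the truth of `EH`/`GEH`, and they do not say `DHL[k, 2]` is unprovable for small `k` (under `GEH`, `DHL[3, 2]` IS proved, by Theorem 3.14) [cite: Polymath8b2014, Theorem 3.2(xii)]; (d) everything concerns the existence statements `DHL[k, m+1]`, not the asymptotic `Literature.NumberTheory.Sieve.GeneralizedHardyLittlewood`; (e) Soundararajan's inequality is transcribed as printed — for real polynomials `Q ≢ 0` with `Q(0) = 0` (there `Q = P^{(k-1)}`), `k ≥ 2` — as a named fact, not proved here, and its reading "GPY with `R < x^{1/4}` cannot give bounded gaps" is the source's for the weights `λ_d = μ(d)P(log(R/d)/log R)` only ("Of course, we just tried one choice of `P`; maybe there is a better choice … Unfortunately, the second fraction in (12) cannot be made larger than `4/k`") [cite: Soundararajan2007SmallGaps, p. 8].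
status: established (Corollary 6.4 is a theorem, formally proved in the tree as `Literature.NumberTheory.Sieve.maynardFunctional_le_holds`; the no-go corollaries (i)–(iii) are proved below; (iv) is a named fact) [cite: Polymath8b2014, Corollary 6.4] -/
def MaynardFunctionalCeiling : Prop :=
  ∀ ⦃k : ℕ⦄, 2 ≤ k → ∀ ⦃F : (Fin k → ℝ) → ℝ⦄, Literature.NumberTheory.Sieve.IsMaynardAdmissible k F →
    Literature.NumberTheory.Sieve.maynardFunctional k F ≤ (k : ℝ) / (k - 1) * Real.log k

/-- **Corollary 6.4 holds** — by the tree's proof `Literature.NumberTheory.Sieve.maynardFunctional_le_holds` (Lemma 6.1 with the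
weights `G_i` of the printed proof). [cite: Polymath8b2014, Corollary 6.4] -/
theorem maynardFunctionalCeiling_holds : MaynardFunctionalCeiling :=
  fun _k hk _F hF => Literature.NumberTheory.Sieve.maynardFunctional_le_holds hk hF

/-- The record is the tree's named fact `Literature.NumberTheory.Sieve.maynardFunctional_le`, up to binder style. [cite: Polymath8b2014, Corollary 6.4] -/
theorem maynardFunctionalCeiling_iff : MaynardFunctionalCeiling ↔ Literature.NumberTheory.Sieve.maynardFunctional_le :=
  ⟨fun h _k hk _F hF => h hk hF, fun h _k hk _F hF => h hk hF⟩

/-- The criterion of Theorem 3.8 forces `2m/θ < (k/(k-1)) log k` (Corollary 6.4 applied to the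
witness). [cite: Polymath8b2014, Corollary 6.4 and Theorem 3.8] -/
theorem MaynardCriterion.lt_ceiling {θ : ℝ} {k m : ℕ} (hc : MaynardCriterion θ k m) (hk : 2 ≤ k) :
    2 * (m : ℝ) / θ < (k : ℝ) / (k - 1) * Real.log k := by
  obtain ⟨F, hF, hM⟩ := hc
  exact hM.trans_le (maynardFunctionalCeiling_holds hk hF)

/-- Contrapositive form: if `(k/(k-1)) log k ≤ 2m/θ` then no admissible `F` meets the criterion of
Theorem 3.8. [cite: Polymath8b2014, Corollary 6.4 and Theorem 3.8] -/
theorem not_maynardCriterion_of_ceiling_le {θ : ℝ} {k m : ℕ} (hk : 2 ≤ k)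
    (h : (k : ℝ) / (k - 1) * Real.log k ≤ 2 * (m : ℝ) / θ) : ¬ MaynardCriterion θ k m :=
  fun hc => absurd ((hc.lt_ceiling hk).trans_le h) (lt_irrefl _)

/-- The criterion forces `k > exp(2m/θ - 1)`, since `(k/(k-1)) log k = log k + (log k)/(k-1) ≤ log k + 1`
(`log k ≤ k - 1`): `m + 1` primes in `k`-tuples through Theorem 3.8 need `k` exponentially large in
`m/θ` (cf. `k ≥ C exp(2m)` in Theorem 3.2(xi), and "the bounds in (vii) and (xi) … cannot be
significantly improved"). [cite: Polymath8b2014, Corollary 6.4 and the remark after Theorem 3.9 (p. 10)] -/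
theorem MaynardCriterion.exp_lt {θ : ℝ} {k m : ℕ} (hc : MaynardCriterion θ k m) (hk : 2 ≤ k) :
    Real.exp (2 * (m : ℝ) / θ - 1) < k := by
  have hlt := hc.lt_ceiling hk
  have hk2 : (2 : ℝ) ≤ k := by exact_mod_cast hk
  have hk0 : (0 : ℝ) < k := by linarith
  have hk1 : (0 : ℝ) < (k : ℝ) - 1 := by linarith
  have hlog : Real.log k ≤ (k : ℝ) - 1 := Real.log_le_sub_one_of_pos hk0
  have hce : (k : ℝ) / (k - 1) * Real.log k ≤ Real.log k + 1 := by
    rw [div_mul_eq_mul_div, div_le_iff₀ hk1]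
    have e : (Real.log k + 1) * ((k : ℝ) - 1) = k * Real.log k + ((k : ℝ) - 1 - Real.log k) := by
      ring
    rw [e]
    linarith
  have h1 : 2 * (m : ℝ) / θ - 1 < Real.log k := by linarith
  calc Real.exp (2 * (m : ℝ) / θ - 1) < Real.exp (Real.log k) := Real.exp_lt_exp.2 h1
    _ = k := Real.exp_log hk0

/-! ### Arithmetic: `(k/(k-1)) log k < 2` for `k ≤ 4`, `< 4` for `k ≤ 50`, `> 4` for `k = 51` -/

namespace MaynardCeilingNumerics

/-- `e₀ⁿ (1 + δ + δ²/2) ≤ exp(n + δ)` for `δ ≥ 0`, `e₀ = 2.7182818283 < e`. [folklore] -/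
theorem exp_nat_add_lower (n : ℕ) {δ : ℝ} (hδ : 0 ≤ δ) :
    (2.7182818283 : ℝ) ^ n * (1 + δ + δ ^ 2 / 2) ≤ Real.exp (n + δ) := by
  rw [Real.exp_add, ← Real.exp_one_pow]
  refine mul_le_mul (pow_le_pow_left₀ (by norm_num) Real.exp_one_gt_d9.le n)
    (Real.quadratic_le_exp_of_nonneg hδ) (by positivity) (by positivity)

/-- `e₀ⁿ (1 - δ) ≤ exp(n - δ)` for `δ ≤ 1`, `e₀ = 2.7182818283 < e`. [folklore] -/
theorem exp_nat_sub_lower (n : ℕ) {δ : ℝ} (hδ : δ ≤ 1) :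
    (2.7182818283 : ℝ) ^ n * (1 - δ) ≤ Real.exp (n - δ) := by
  rw [show (n : ℝ) - δ = n + -δ from sub_eq_add_neg _ _, Real.exp_add, ← Real.exp_one_pow]
  refine mul_le_mul (pow_le_pow_left₀ (by norm_num) Real.exp_one_gt_d9.le n)
    (by linarith [Real.add_one_le_exp (-δ)]) (by linarith) (by positivity)

/-- `x < exp c` from `c = n + δ`, `δ ≥ 0` and `x < e₀ⁿ(1 + δ + δ²/2)`. [folklore] -/
theorem lt_exp_of_pos_part {x c : ℝ} (n : ℕ) (δ : ℝ) (hδ : 0 ≤ δ) (hc : c = n + δ)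
    (hx : x < (2.7182818283 : ℝ) ^ n * (1 + δ + δ ^ 2 / 2)) : x < Real.exp c := by
  rw [hc]
  exact hx.trans_le (exp_nat_add_lower n hδ)

/-- `x < exp c` from `c = n - δ`, `δ ≤ 1` and `x < e₀ⁿ(1 - δ)`. [folklore] -/
theorem lt_exp_of_neg_part {x c : ℝ} (n : ℕ) (δ : ℝ) (hδ : δ ≤ 1) (hc : c = n - δ)
    (hx : x < (2.7182818283 : ℝ) ^ n * (1 - δ)) : x < Real.exp c := by
  rw [hc]
  exact hx.trans_le (exp_nat_sub_lower n hδ)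

/-- Range step: if `a ≤ k ≤ b` and `b < exp(C - C/a)` then `log k ≤ log b < C - C/a ≤ C - C/k`, i.e.
`(k/(k-1)) log k < C`. [folklore] -/
theorem ceiling_lt_of_range {k a b : ℕ} {C : ℝ} (hC : 0 ≤ C) (hk : 2 ≤ k) (hak : a ≤ k)
    (hkb : k ≤ b) (ha : 1 ≤ a) (hb : (b : ℝ) < Real.exp (C - C / a)) :
    (k : ℝ) / (k - 1) * Real.log k < C := by
  have hk2 : (2 : ℝ) ≤ k := by exact_mod_cast hk
  have hk0 : (0 : ℝ) < k := by linarith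
  have hk1 : (0 : ℝ) < (k : ℝ) - 1 := by linarith
  have ha0 : (0 : ℝ) < a := by exact_mod_cast (show 0 < a by omega)
  have hb0 : (0 : ℝ) < b := by exact_mod_cast (show 0 < b by omega)
  have h1 : Real.log k ≤ Real.log b := Real.log_le_log hk0 (by exact_mod_cast hkb)
  have h2 : Real.log b < C - C / a := (Real.log_lt_iff_lt_exp hb0).2 hb
  have h3 : C / k ≤ C / a := div_le_div_of_nonneg_left hC ha0 (by exact_mod_cast hak)
  have h4 : Real.log k < C - C / k := by linarith
  rw [div_mul_eq_mul_div, div_lt_iff₀ hk1]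
  have h5 : (k : ℝ) * Real.log k < k * (C - C / k) := mul_lt_mul_of_pos_left h4 hk0
  have h6 : (k : ℝ) * (C - C / k) = C * (k - 1) := by
    rw [mul_sub, mul_div_assoc', mul_div_cancel_left₀ C hk0.ne']
    ring
  linarith

/-- `x < exp c` from `c = n + δ`, `δ ≥ 0` and `x < e₀ⁿ(1 + δ + δ²/2 + δ³/6)` (three Taylor terms,
`Real.sum_le_exp_of_nonneg`). [folklore] -/
theorem lt_exp_of_pos_part3 {x c : ℝ} (n : ℕ) (δ : ℝ) (hδ : 0 ≤ δ) (hc : c = n + δ)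
    (hx : x < (2.7182818283 : ℝ) ^ n * (1 + δ + δ ^ 2 / 2 + δ ^ 3 / 6)) : x < Real.exp c := by
  rw [hc, Real.exp_add, ← Real.exp_one_pow]
  have h4 := Real.sum_le_exp_of_nonneg hδ 4
  simp only [Finset.sum_range_succ, Finset.sum_range_zero, Nat.factorial, Nat.cast_ofNat,
    Nat.cast_succ, pow_zero, pow_one] at h4
  have h5 : 1 + δ + δ ^ 2 / 2 + δ ^ 3 / 6 ≤ Real.exp δ := by
    convert h4 using 1
    norm_num
  refine hx.trans_le (mul_le_mul (pow_le_pow_left₀ (by norm_num) Real.exp_one_gt_d9.le n) h5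
    (by positivity) (by positivity))

/-- Range step for `log(2k - 1)`: if `a ≤ k ≤ b` and `2b - 1 < exp(C - C/a)` then
`(k/(k-1)) log(2k-1) < C`. [folklore] -/
theorem epsCeiling_lt_of_range {k a b : ℕ} {C : ℝ} (hC : 0 ≤ C) (hk : 2 ≤ k) (hak : a ≤ k)
    (hkb : k ≤ b) (ha : 1 ≤ a) (hb : (2 * (b : ℝ) - 1) < Real.exp (C - C / a)) :
    (k : ℝ) / (k - 1) * Real.log (2 * k - 1) < C := by
  have hk2 : (2 : ℝ) ≤ k := by exact_mod_cast hk
  have hk0 : (0 : ℝ) < k := by linarith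
  have hk1 : (0 : ℝ) < (k : ℝ) - 1 := by linarith
  have ha0 : (0 : ℝ) < a := by exact_mod_cast (show 0 < a by omega)
  have hkb' : (k : ℝ) ≤ b := by exact_mod_cast hkb
  have h1 : Real.log (2 * k - 1) ≤ Real.log (2 * b - 1) :=
    Real.log_le_log (by linarith) (by linarith)
  have h2 : Real.log (2 * b - 1) < C - C / a := (Real.log_lt_iff_lt_exp (by linarith)).2 hb
  have h3 : C / k ≤ C / a := div_le_div_of_nonneg_left hC ha0 (by exact_mod_cast hak)
  have h4 : Real.log (2 * k - 1) < C - C / k := by linarith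
  rw [div_mul_eq_mul_div, div_lt_iff₀ hk1]
  have h5 : (k : ℝ) * Real.log (2 * k - 1) < k * (C - C / k) := mul_lt_mul_of_pos_left h4 hk0
  have h6 : (k : ℝ) * (C - C / k) = C * (k - 1) := by
    rw [mul_sub, mul_div_assoc', mul_div_cancel_left₀ C hk0.ne']
    ring
  linarith

end MaynardCeilingNumerics

open MaynardCeilingNumerics

/-- `(k/(k-1)) log k < 2` for `k = 2, 3, 4` (the source prints `M_2 ≤ 2 log 2 = 1.38629…`,
`M_4 ≤ (4/3) log 4 = 1.8454…` [sic; the value is `1.8484…`]); here from `e > 2.7182818283`: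
`2 < e`, `3 < e(1 + 1/3 + 1/18)`, `4 < e(1 + 1/2 + 1/8)`. [cite: Polymath8b2014, §6 (remark after Corollary 6.4)] -/
theorem ceiling_lt_two {k : ℕ} (hk2 : 2 ≤ k) (hk4 : k ≤ 4) :
    (k : ℝ) / (k - 1) * Real.log k < 2 := by
  have hC : (0 : ℝ) ≤ 2 := by norm_num
  interval_cases k
  · exact ceiling_lt_of_range (a := 2) (b := 2) hC le_rfl le_rfl le_rfl (by norm_num)
      (lt_exp_of_pos_part 1 0 le_rfl (by norm_num) (by norm_num))
  · exact ceiling_lt_of_range (a := 3) (b := 3) hC (by norm_num) le_rfl le_rfl (by norm_num)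
      (lt_exp_of_pos_part 1 (1 / 3) (by norm_num) (by norm_num) (by norm_num))
  · exact ceiling_lt_of_range (a := 4) (b := 4) hC (by norm_num) le_rfl le_rfl (by norm_num)
      (lt_exp_of_pos_part 1 (1 / 2) (by norm_num) (by norm_num) (by norm_num))

/-- `(k/(k-1)) log k < 4` for `2 ≤ k ≤ 50` (arithmetic instance of Corollary 6.4 at the
Bombieri–Vinogradov threshold `2m/θ = 4`; `(50/49) log 50 = 3.9918…`). Proof by ranges
`[2,4], [5,12], [13,33], [34,45], [46,49], {50}`: on `[a, b]`, `log k ≤ log b < 4 - 4/a ≤ 4 - 4/k`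
with `b < exp(4 - 4/a)` from `e > 2.7182818283` and `exp δ ≥ 1 + δ + δ²/2`, `exp(-δ) ≥ 1 - δ`. [folklore] -/
theorem ceiling_lt_four {k : ℕ} (hk2 : 2 ≤ k) (hk : k ≤ 50) :
    (k : ℝ) / (k - 1) * Real.log k < 4 := by
  have hC : (0 : ℝ) ≤ 4 := by norm_num
  rcases le_or_gt k 4 with h₁ | h₁
  · exact ceiling_lt_of_range (a := 2) (b := 4) hC hk2 hk2 h₁ (by norm_num)
      (lt_exp_of_pos_part 2 0 le_rfl (by norm_num) (by norm_num))
  rcases le_or_gt k 12 with h₂ | h₂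
  · exact ceiling_lt_of_range (a := 5) (b := 12) hC hk2 (by omega) h₂ (by norm_num)
      (lt_exp_of_pos_part 3 (1 / 5) (by norm_num) (by norm_num) (by norm_num))
  rcases le_or_gt k 33 with h₃ | h₃
  · exact ceiling_lt_of_range (a := 13) (b := 33) hC hk2 (by omega) h₃ (by norm_num)
      (lt_exp_of_pos_part 3 (9 / 13) (by norm_num) (by norm_num) (by norm_num))
  rcases le_or_gt k 45 with h₄ | h₄
  · exact ceiling_lt_of_range (a := 34) (b := 45) hC hk2 (by omega) h₄ (by norm_num)
      (lt_exp_of_pos_part 3 (15 / 17) (by norm_num) (by norm_num) (by norm_num))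
  rcases le_or_gt k 49 with h₅ | h₅
  · exact ceiling_lt_of_range (a := 46) (b := 49) hC hk2 (by omega) h₅ (by norm_num)
      (lt_exp_of_neg_part 4 (2 / 23) (by norm_num) (by norm_num) (by norm_num))
  · obtain rfl : k = 50 := by omega
    exact ceiling_lt_of_range (a := 50) (b := 50) hC hk2 le_rfl le_rfl (by norm_num)
      (lt_exp_of_neg_part 4 (2 / 25) (by norm_num) (by norm_num) (by norm_num))

/-- The arithmetic threshold of (ii) is exactly `k ≤ 50`: already `(51/50) log 51 > 4`
(`log 51 > 200/51` since `exp(200/51) = e⁴ exp(-4/51) ≤ 2.7182818286⁴ · (51/55) < 51`).  Corollary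
6.4 alone therefore does not exclude `k = 51` at the Bombieri–Vinogradov threshold (and "the
possibility that `M_53` exceeds `4`" is left open in the source). [cite: Polymath8b2014, §11 (p. 37)] -/
theorem four_lt_ceiling_fiftyOne : (4 : ℝ) < (51 : ℝ) / (51 - 1) * Real.log 51 := by
  have hexp : Real.exp (200 / 51) < 51 := by
    have e1 : (200 : ℝ) / 51 = (4 : ℕ) + -(4 / 51) := by norm_num
    rw [e1, Real.exp_add, ← Real.exp_one_pow]
    have hpow : Real.exp 1 ^ 4 ≤ (2.7182818286 : ℝ) ^ 4 :=
      pow_le_pow_left₀ (Real.exp_pos 1).le Real.exp_one_lt_d9.le 4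
    have hneg : Real.exp (-(4 / 51 : ℝ)) ≤ 51 / 55 := by
      have h := Real.add_one_le_exp (4 / 51 : ℝ)
      rw [Real.exp_neg, inv_le_comm₀ (Real.exp_pos _) (by norm_num)]
      linarith
    calc Real.exp 1 ^ 4 * Real.exp (-(4 / 51 : ℝ)) ≤ (2.7182818286 : ℝ) ^ 4 * (51 / 55) :=
          mul_le_mul hpow hneg (Real.exp_pos _).le (by positivity)
      _ < 51 := by norm_num
  have hlog : (200 : ℝ) / 51 < Real.log 51 := (Real.lt_log_iff_exp_lt (by norm_num)).2 hexp
  linarith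

/-! ### The no-go theorems -/

/-- **Polymath 8b, remark after Corollary 6.4, formal: no prime pairs from Theorem 3.8 with `k ≤ 4`
at any level `θ ≤ 1`.**  For `0 < θ ≤ 1` and `k ∈ {2, 3, 4}` no admissible `F` on `R_k` has
`(∑ᵢ J_k^{(i)}(F))/I_k(F) > 2/θ`: "one cannot hope to establish `DHL[4,2]` (or `DHL[3,2]`) solely
through Theorem 3.8 even when assuming GEH".  (`θ ≤ 1` covers `EH[θ]` for every `θ < 1`, tree
`Literature.NumberTheory.Sieve.LevelOfDistribution.ElliottHalberstam`.) [cite: Polymath8b2014, §6 (remark after Corollary 6.4, p. 24)] -/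
theorem not_maynardCriterion_pairs_of_le_one {θ : ℝ} (hθ : 0 < θ) (hθ1 : θ ≤ 1) {k : ℕ}
    (hk2 : 2 ≤ k) (hk4 : k ≤ 4) : ¬ MaynardCriterion θ k 1 := by
  refine not_maynardCriterion_of_ceiling_le hk2 ((ceiling_lt_two hk2 hk4).le.trans ?_)
  rw [Nat.cast_one, mul_one, le_div_iff₀ hθ]
  linarith

/-- **No prime pairs from Theorem 3.8 with `k ≤ 50` at Bombieri–Vinogradov level.**  For
`0 < θ ≤ 1/2` (tree `Literature.BombieriVinogradovStatement : ∀ θ < 1/2, PrimesHaveLevel θ`) and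
`2 ≤ k ≤ 50` no admissible `F` on `R_k` has `(∑ᵢ J_k^{(i)}(F))/I_k(F) > 2/θ ≥ 4` — the arithmetic
instance `(k/(k-1)) log k < 4` (`k ≤ 50`) of Corollary 6.4; the printed unconditional use of
Theorem 3.8 is `DHL[54, 2]` from `M_54 > 4.00238`, and `DHL[50, 2]` (`H₁ ≤ 246`) goes through
Theorem 3.12 instead. [cite: Polymath8b2014, Corollary 6.4, Theorem 3.9(vii) and Theorem 3.13(i)] -/
theorem not_maynardCriterion_pairs_of_le_half {θ : ℝ} (hθ : 0 < θ) (hθ2 : θ ≤ 1 / 2) {k : ℕ}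
    (hk2 : 2 ≤ k) (hk : k ≤ 50) : ¬ MaynardCriterion θ k 1 := by
  refine not_maynardCriterion_of_ceiling_le hk2 ((ceiling_lt_four hk2 hk).le.trans ?_)
  rw [Nat.cast_one, mul_one, le_div_iff₀ hθ]
  linarith

/-- **The class is inhabited from `k = 5` on (Maynard's `M_5 > 2`)**: at level `θ = 1` the criterion
for pairs holds with `k = 5`, by the tree's PROVED `Literature.NumberTheory.Sieve.exists_two_lt_maynardFunctional_five_holds`
(Maynard's polynomial, ratio `1417255/708216 = 2.0011…`); so (i) is sharp in `k`, and under `EH`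
Theorem 3.8 gives `DHL[5, 2]`, `H₁ ≤ 12`. [cite: MaynardAnnals2015, Proposition 4.3] -/
theorem maynardCriterion_five : MaynardCriterion 1 5 1 :=
  ⟨Literature.NumberTheory.Sieve.MaynardTao.maynardF5, Literature.NumberTheory.Sieve.MaynardTao.isMaynardAdmissible_maynardF5, by
    rw [Literature.NumberTheory.Sieve.MaynardTao.maynardFunctional_maynardF5]; norm_num⟩

/-- **The class is inhabited at Bombieri–Vinogradov level from `k = 105` on (Maynard's
`M_105 > 4`)**: `MaynardCriterion (1/2) 105 1`, by the tree's PROVED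
`Literature.NumberTheory.Sieve.exists_four_lt_maynardFunctional_holds` (`Literature/NumberTheory/Sieve/MaynardK105.lean`); so
(ii) leaves open exactly `51 ≤ k ≤ 104` for Theorem 3.8 at threshold `4` as far as the tree's proved
facts go (the source has `M_54 > 4.00238`, numerically). [cite: MaynardAnnals2015, Proposition 4.3] -/
theorem maynardCriterion_oneOhFive : MaynardCriterion (1 / 2) 105 1 := by
  obtain ⟨F, hF, h4⟩ := Literature.NumberTheory.Sieve.exists_four_lt_maynardFunctional_holds
  exact ⟨F, hF, by norm_num; exact h4⟩

/-! ### The predecessor ceiling: one-dimensional GPY weights (named fact) -/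

/-- **Soundararajan's ceiling `4` for the Goldston–Pintz–Yıldırım weights** (as printed): for every
polynomial `Q`, not identically zero, with `Q(0) = 0`,
`∫₀¹ (y^{k-2}/(k-2)!) Q(1-y)² dy < (4/k) ∫₀¹ (y^{k-1}/(k-1)!) Q′(1-y)² dy`;
with `Q = P^{(k-1)}` this says that the sieve ratio (12) of the weights
`λ_d = μ(d) P(log(R/d)/log R)` is `< (log R/log x) · 4/k`, hence `< 1/k` for `R` below `x^{1/4}`
("We therefore barely fail to prove bounded gaps between primes!"; "the analogue of `M_k` in this
special case cannot exceed `4`").  Stated for `k ≥ 2` (the size of the tuple).  Named fact, not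
proved here. [cite: Soundararajan2007SmallGaps, p. 8] -/
def Soundararajan2007_gpyCeiling : Prop :=
  ∀ (k : ℕ), 2 ≤ k → ∀ Q : Polynomial ℝ, Q ≠ 0 → Q.eval 0 = 0 →
    (∫ y in (0 : ℝ)..1, y ^ (k - 2) / ((k - 2).factorial : ℝ) * (Q.eval (1 - y)) ^ 2) <
      4 / (k : ℝ) * ∫ y in (0 : ℝ)..1,
        y ^ (k - 1) / ((k - 1).factorial : ℝ) * ((Polynomial.derivative Q).eval (1 - y)) ^ 2

/-! ### The ε-enlarged functional of Theorem 3.12: the printed ceiling (named fact) -/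

/-- **Polymath 8b, Proposition 6.5** (as printed): "For any `k ≥ 2` and `0 ≤ ε < 1` we have
`M_{k,ε} ≤ (k/(k-1)) log(2k-1)`."  Rendered `sSup`-free on the tree's `Literature.polymathFunctional k ε F`
and `Literature.IsPolymathTestFunction k ε F` — the functional `(∑ᵢ J_{i,1-ε}(F))/I(F)` and the test
functions (square-integrable, supported on `(1+ε)·R_k`, not a.e. zero) of Theorem 3.12 as rendered in
`Literature/NumberTheory/Sieve/PolymathBoundedGaps.lean`. Named fact, PROVED in the tree:
`Literature.NumberTheory.Sieve.polymathFunctional_le_log` (`PolymathMkEpsUpperBound.lean`), discharged as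
`Polymath2014_epsFunctional_le_holds` in the sibling `MaynardFunctionalCeilingProofs.lean`.  (The printed
proof — Lemma 6.1 with the weight `1 - t₁ - ⋯ - t_k + k t_i` on fibres of length `s + ε`, `s ≥ ε` — is
incomplete: summing in `i` needs `∑ᵢ 1_{Eᵢ}(1 - σ + k tᵢ) ≤ k`, false on `σ > 1`; the tree's proof uses a
two-zone weight instead; the STATEMENT is as printed.) [cite: Polymath8b2014, Proposition 6.5] -/
def Polymath2014_epsFunctional_le : Prop :=
  ∀ ⦃k : ℕ⦄, 2 ≤ k → ∀ ⦃ε : ℝ⦄, 0 ≤ ε → ε < 1 → ∀ ⦃F : (Fin k → ℝ) → ℝ⦄,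
    Literature.NumberTheory.Sieve.IsPolymathTestFunction k ε F →
      Literature.NumberTheory.Sieve.polymathFunctional k ε F ≤ (k : ℝ) / (k - 1) * Real.log (2 * k - 1)

/-- **The ε-criterion of Theorem 3.12**: some test function on `(1+ε)·R_k` has
`(∑ᵢ J_{i,1-ε}(F))/I(F) > 2m/θ` — the variational hypothesis "`M_{k,ε} > 2m/θ`" of Theorem 3.12,
exactly as in the tree's rendering `Literature.NumberTheory.Sieve.weakDHL_of_polymathFunctional_gt` of Theorem 3.12(i). [cite: Polymath8b2014, Theorem 3.12] -/
def PolymathCriterion (θ ε : ℝ) (k m : ℕ) : Prop :=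
  ∃ F : (Fin k → ℝ) → ℝ, Literature.NumberTheory.Sieve.IsPolymathTestFunction k ε F ∧ 2 * (m : ℝ) / θ < Literature.NumberTheory.Sieve.polymathFunctional k ε F

/-- `(k/(k-1)) log(2k-1) < 4` for `2 ≤ k ≤ 23` (arithmetic instance of Proposition 6.5 at the
Bombieri–Vinogradov threshold; `(23/22) log 45 = 3.9797…`), by the ranges
`[2,4], [5,12], [13,17], [18,20], [21,22], {23}`. [folklore] -/
theorem epsCeiling_lt_four {k : ℕ} (hk2 : 2 ≤ k) (hk : k ≤ 23) :
    (k : ℝ) / (k - 1) * Real.log (2 * k - 1) < 4 := by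
  have hC : (0 : ℝ) ≤ 4 := by norm_num
  rcases le_or_gt k 4 with h₁ | h₁
  · exact epsCeiling_lt_of_range (a := 2) (b := 4) hC hk2 hk2 h₁ (by norm_num)
      (lt_exp_of_pos_part 2 0 le_rfl (by norm_num) (by norm_num))
  rcases le_or_gt k 12 with h₂ | h₂
  · exact epsCeiling_lt_of_range (a := 5) (b := 12) hC hk2 (by omega) h₂ (by norm_num)
      (lt_exp_of_pos_part 3 (1 / 5) (by norm_num) (by norm_num) (by norm_num))
  rcases le_or_gt k 17 with h₃ | h₃
  · exact epsCeiling_lt_of_range (a := 13) (b := 17) hC hk2 (by omega) h₃ (by norm_num)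
      (lt_exp_of_pos_part 3 (9 / 13) (by norm_num) (by norm_num) (by norm_num))
  rcases le_or_gt k 20 with h₄ | h₄
  · exact epsCeiling_lt_of_range (a := 18) (b := 20) hC hk2 (by omega) h₄ (by norm_num)
      (lt_exp_of_pos_part 3 (7 / 9) (by norm_num) (by norm_num) (by norm_num))
  rcases le_or_gt k 22 with h₅ | h₅
  · exact epsCeiling_lt_of_range (a := 21) (b := 22) hC hk2 (by omega) h₅ (by norm_num)
      (lt_exp_of_pos_part3 3 (17 / 21) (by norm_num) (by norm_num) (by norm_num))
  · obtain rfl : k = 23 := by omega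
    exact epsCeiling_lt_of_range (a := 23) (b := 23) hC hk2 le_rfl le_rfl (by norm_num)
      (lt_exp_of_pos_part3 3 (19 / 23) (by norm_num) (by norm_num) (by norm_num))

/-- The arithmetic threshold is exactly `k ≤ 23`: `(24/23) log 47 > 4` (`log 47 > 23/6` since
`exp(23/6) = e⁴ exp(-1/6) ≤ 2.7182818286⁴ · (6/7) < 47`). [folklore] -/
theorem four_lt_epsCeiling_twentyFour : (4 : ℝ) < (24 : ℝ) / (24 - 1) * Real.log (2 * 24 - 1) := by
  have hexp : Real.exp (23 / 6) < 47 := by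
    have e1 : (23 : ℝ) / 6 = (4 : ℕ) + -(1 / 6) := by norm_num
    rw [e1, Real.exp_add, ← Real.exp_one_pow]
    have hpow : Real.exp 1 ^ 4 ≤ (2.7182818286 : ℝ) ^ 4 :=
      pow_le_pow_left₀ (Real.exp_pos 1).le Real.exp_one_lt_d9.le 4
    have hneg : Real.exp (-(1 / 6 : ℝ)) ≤ 6 / 7 := by
      have h := Real.add_one_le_exp (1 / 6 : ℝ)
      rw [Real.exp_neg, inv_le_comm₀ (Real.exp_pos _) (by norm_num)]
      linarith
    calc Real.exp 1 ^ 4 * Real.exp (-(1 / 6 : ℝ)) ≤ (2.7182818286 : ℝ) ^ 4 * (6 / 7) :=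
          mul_le_mul hpow hneg (Real.exp_pos _).le (by positivity)
      _ < 47 := by norm_num
  have hlog : (23 : ℝ) / 6 < Real.log 47 := (Real.lt_log_iff_exp_lt (by norm_num)).2 hexp
  norm_num
  linarith

/-- **No prime pairs from Theorem 3.12 with `k ≤ 23` at Bombieri–Vinogradov level, modulo
Proposition 6.5.**  If `Polymath2014_epsFunctional_le` holds, then for `0 < θ ≤ 1/2`, `0 ≤ ε < 1`
and `2 ≤ k ≤ 23` no test function meets the ε-criterion with `m = 1` (`2/θ ≥ 4 > (k/(k-1)) log(2k-1)`);
the printed use is `k = 50`, `ε = 1/25` (`M_{50,1/25} > 4.0043`, `H₁ ≤ 246`). At threshold `2`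
(`θ ≤ 1`) Proposition 6.5 excludes nothing, since `2 log 3 > 2`. [cite: Polymath8b2014, Proposition 6.5 and Theorem 3.13(i)] -/
theorem not_polymathCriterion_pairs_of_le_half (h65 : Polymath2014_epsFunctional_le) {θ ε : ℝ}
    (hθ : 0 < θ) (hθ2 : θ ≤ 1 / 2) (hε0 : 0 ≤ ε) (hε1 : ε < 1) {k : ℕ} (hk2 : 2 ≤ k)
    (hk : k ≤ 23) : ¬ PolymathCriterion θ ε k 1 := by
  rintro ⟨F, hF, hM⟩
  have h1 : Literature.NumberTheory.Sieve.polymathFunctional k ε F < 4 := (h65 hk2 hε0 hε1 hF).trans_lt (epsCeiling_lt_four hk2 hk)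
  have h2 : (4 : ℝ) ≤ 2 * ((1 : ℕ) : ℝ) / θ := by
    rw [Nat.cast_one, mul_one, le_div_iff₀ hθ]
    linarith
  linarith

end Literature.Barriers.Parity
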